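import Mathlib
import Summits.KontsevichZagierPeriods.Zeta5Search.Families.ExactS9aValue
import Summits.KontsevichZagierPeriods.Zeta5Search.Families.ExactS9bValue
import Summits.KontsevichZagierPeriods.Zeta5Search.Families.BasicGrowthFive
import HarnessLib

/-!
# ζ(5) search — Families: two nine-point configurations in radicals — `M_{S9a} = φ^{-15} = M_{₅π}³`, `M_{S9b} = (2−√3)^6`

HONEST FRAMING: systematic search; no irrationality claim unless certified.  STRUCTURAL facts about the size of
Brown's basic cellular integrals [Brown2016, §1.5] (seat P2, Families layer); nothing about the arithmetic of any zeta
value.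

Two quadratic entries of the exact atlas with `N = 9` (`Families/ExactS9aValue`, `Families/ExactS9bValue`):
* **`fSup_S9a_eq`** — `sigmaS9a = (0,2,4,7,3,5,8,1,6)` (printed plan `[1,3,5,8,4,6,9,2,7]`) has
  `M = 305√5 − 682 = ((√5−1)/2)^{15} = φ^{-15}`, the CUBE of the growth constant of Brown's five-point plan:
  `fSup_S9a_eq_fSup_sigma5_cube` (so `φ^{-5}, φ^{-10}, φ^{-15}` occur at `N = 5, 7, 9`);
* **`fSup_S9b_eq`** — `sigmaS9b = (0,2,4,6,1,7,3,8,5)` (printed plan `[1,3,5,7,2,8,4,9,6]`) has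
  `M = 1351 − 780√3 = (2 − √3)^6`.
Standard axioms only.
-/

noncomputable section

open MeasureTheory Set Finset Filter Topology

namespace Summit.KontsevichZagierPeriods.Zeta5Search.Families.Cellular

/-- **`M_{S9a} = ((√5 − 1)/2)^{15}`** (`= φ^{-15} = 305√5 − 682 = 0.000733137…`). -/
theorem fSup_S9a_eq : fSup sigmaS9a = ((Real.sqrt 5 - 1) / 2) ^ 15 := by
  have hs : Real.sqrt 5 ^ 2 = 5 := Real.sq_sqrt (by norm_num)
  have hs0 : 0 ≤ Real.sqrt 5 := Real.sqrt_nonneg 5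
  have hs2 : 2 < Real.sqrt 5 := by nlinarith [hs, hs0]
  set M := fSup sigmaS9a with hM
  have hp : -1 + 1364 * M + M ^ 2 = 0 := by
    have h := minpoly_fSup_S9a
    unfold minpolyS9a at h
    linear_combination h
  have hpos : 0 < M := by have := fSup_S9a_mem_Ioo.1; norm_num at this; linarith
  -- `(M − r₁)(M − r₂) = minpoly`, `r₁ = 305√5 − 682`, `r₂ = −305√5 − 682 < 0`
  have hfac : (M - (305 * Real.sqrt 5 - 682)) * (M - (-305 * Real.sqrt 5 - 682)) = 0 := by
    linear_combination hp - 93025 * hs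
  have hr2 : M - (-305 * Real.sqrt 5 - 682) ≠ 0 := by nlinarith [hs0, hpos]
  have hM1 : M = 305 * Real.sqrt 5 - 682 := by
    rcases mul_eq_zero.1 hfac with h | h
    · linarith
    · exact absurd h hr2
  rw [hM1]
  have h2 : ((Real.sqrt 5 - 1) / 2) ^ 2 = (3 - Real.sqrt 5) / 2 := by linear_combination (1 / 4) * hs
  have h3 : ((Real.sqrt 5 - 1) / 2) ^ 3 = Real.sqrt 5 - 2 := by
    linear_combination ((Real.sqrt 5 - 3) / 8) * hs
  have h15 : ((Real.sqrt 5 - 1) / 2) ^ 15 = (((Real.sqrt 5 - 1) / 2) ^ 3) ^ 5 := by ring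
  rw [h15, h3]
  linear_combination (130 - 45 * Real.sqrt 5 + 10 * Real.sqrt 5 ^ 2 - Real.sqrt 5 ^ 3) * hs

/-- **`M_{S9a} = M_{₅π}³`**: the growth constant of `sigmaS9a` is the cube of that of Brown's five-point plan
(`fSup_sigma5 = ((√5−1)/2)^5`). -/
theorem fSup_S9a_eq_fSup_sigma5_cube : fSup sigmaS9a = fSup sigma5 ^ 3 := by
  rw [fSup_S9a_eq, fSup_sigma5]; ring

/-- **`M_{S9b} = (2 − √3)^6`** (`= 1351 − 780√3 = 0.000370096…`). -/
theorem fSup_S9b_eq : fSup sigmaS9b = (2 - Real.sqrt 3) ^ 6 := by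
  have hs : Real.sqrt 3 ^ 2 = 3 := Real.sq_sqrt (by norm_num)
  have hs0 : 0 ≤ Real.sqrt 3 := Real.sqrt_nonneg 3
  have hs1 : 1 < Real.sqrt 3 := by nlinarith [hs, hs0]
  set M := fSup sigmaS9b with hM
  have hp : 1 - 2702 * M + M ^ 2 = 0 := by
    have h := minpoly_fSup_S9b
    unfold minpolyS9b at h
    linear_combination h
  have hlt : M < 1 := by have := fSup_S9b_mem_Ioo.2; norm_num at this; linarith
  have hfac : (M - (1351 - 780 * Real.sqrt 3)) * (M - (1351 + 780 * Real.sqrt 3)) = 0 := by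
    linear_combination hp - 608400 * hs
  have hr2 : M - (1351 + 780 * Real.sqrt 3) ≠ 0 := by nlinarith [hs0, hlt]
  have hM1 : M = 1351 - 780 * Real.sqrt 3 := by
    rcases mul_eq_zero.1 hfac with h | h
    · linarith
    · exact absurd h hr2
  rw [hM1]
  have h2 : (2 - Real.sqrt 3) ^ 2 = 7 - 4 * Real.sqrt 3 := by linear_combination hs
  have h6 : (2 - Real.sqrt 3) ^ 6 = ((2 - Real.sqrt 3) ^ 2) ^ 3 := by ring
  rw [h6, h2]
  linear_combination (64 * Real.sqrt 3 - 336) * hs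

end Summit.KontsevichZagierPeriods.Zeta5Search.Families.Cellular
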